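import Summits.ResolutionOfSingularities.ResolutionOfSingularities.Theorems.EquisingularLiftEquisingularLiftNatNDFanSeparation
import Summits.ResolutionOfSingularities.ResolutionOfSingularities.Theorems.EquisingularLiftEquisingularLiftNatNDRoundModelSplit
import HarnessLib

/-!
# [OURS · L1 W4.5(b) · EL♮(3) · ND-K5 brick (B4α0) 3/3] ★ `playFacts : ND.PlayFacts n` — THE COMBINATORIAL DRIVER of the toric model round, PROVED:
# every won E1-legal play from the orthant on a convenient nonempty table yields a HEAD-STYLE GOOD play from the point-star position to a won position

OURS · L1 W4.5(b) · EL♮(3) stmt-ResolutionOfSingularities-20148 · counted 0 · AI-written (res-L1-w45b-iso-w3 g0, WIDTH TABLE D1′ row iso-w3 (2/2),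
desk res-L1-w45b-plan-1 g21 2026-08-28T14:40:28Z), weaker than expert review; nothing of [Hironaka2017] asserted; no statement of the manuscript.
Sorry-free, standard axioms, DEF-FREE, no instance, no notation. `--supports stmt-ResolutionOfSingularities-20148 --as helper`: support module toward the
registered 4th CHILD stub `stub_elnat_three_isolated_newtonNondegenerate` through the ND-K5 brick **(B4α0) `playFacts : ND.PlayFacts n`** of SPEC v9/v10
`Cruxes/EquisingularLiftNatThree/NewtonNondegenerateRungK5.lean` §13.14 (res-L1-w45b-idea-1 ROUND 12): the COMBINATORIAL DRIVER of the toric model round.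
Dim-3 char-p resolution is a theorem in print (Cossart–Piltant 2008/2009); everything here is OUR kernel-own bookkeeping of the local fan game of
`…NatResidueHypDefsND` (p625534: `Ray`, `pair`, `Bad`, `star`, `Reach`, `Won`, `e`, `orthantFan`, `IsConvenientTable`) and `…NatNDChartPlays`
(`IsSmoothCone`, `zMat`, `rayOf`, `isSmoothCone_starCone`, `not_bad_coordinateFace`, `pair_e`).

PROOF (OURS): (1) head inversion of the tail-recursive `Reach` (`reach_eq_or_exists_first_move`); the first move of any play on a convenient table is the
full-frame star (`eq_frame_of_bad_subset_frame`), and a won orthant forces `n ≤ 1`, where the point-star position is won as well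
(`won_pointStar_of_won_orthant`); (2) along the rest of the play three facts survive every legal star (`invariant_of_reach`, from 1/3 and 2/3): every
maximal cone is SMOOTH, NO cone contains the whole frame, and any two maximal cones are SEPARATED by an integral functional; they hold at the point-star
position when the frame is `Bad` (`invariant_pointStar`); (3) hence every later legal centre has a NON-FRAME ray (convenience) and its new ray is FRESH
(separation), i.e. the play IS a `GoodPlay` (`goodPlay_of_reach`, appending moves with `goodPlay_snoc`); the won position returned is the given one.
Closes `playFacts` BY NAME against the text owner's port `…NatNDRoundModelSplit` (`ND.GoodPlay`, `ND.PlayFacts`, SPEC §13.14 VERBATIM).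
-/

noncomputable section

set_option linter.dupNamespace false

open Matrix

namespace Summit.ResolutionOfSingularities.ResolutionOfSingularities.Cruxes.EquisingularLiftNat.Sections.ND

open Summit.ResolutionOfSingularities.ResolutionOfSingularities.Cruxes.EquisingularLiftNat.Sections

variable {n : ℕ}

/-! ### A. Plays: head inversion of `Reach`, appending a good move to a `GoodPlay` -/

/-- **Head inversion of the tail-recursive `Reach`**: a play is empty or starts with ONE legal star followed by a play.
[OURS · L1 W4.5b · (B4α0) plumbing] -/
theorem reach_eq_or_exists_first_move {V : Finset (Fin n → ℕ)} {F F' : Finset (Finset (Ray n))} (h : Reach V F F') :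
    F = F' ∨ ∃ σ ∈ F, ∃ τ : Finset (Ray n), τ ⊆ σ ∧ τ.Nonempty ∧ Bad V τ ∧ Reach V (star F τ) F' := by
  induction h with
  | refl => exact Or.inl rfl
  | step F₂ τ σ hR hσ hτ hne hB ih =>
    rcases ih with rfl | ⟨σ₀, hσ₀, τ₀, hτ₀, hne₀, hB₀, hR₀⟩
    · exact Or.inr ⟨σ, hσ, τ, hτ, hne, hB, Reach.refl _⟩
    · exact Or.inr ⟨σ₀, hσ₀, τ₀, hτ₀, hne₀, hB₀, Reach.step _ _ τ σ hR₀ hσ hτ hne hB⟩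

/-- **Appending a good move at the END of a head-style good play.** [OURS · L1 W4.5b · (B4α0) plumbing] -/
theorem goodPlay_snoc {V : Finset (Fin n → ℕ)} {Φ Φ' : Finset (Finset (Ray n))} (h : GoodPlay n V Φ Φ')
    {σ τ : Finset (Ray n)} (hσ : σ ∈ Φ') (hτ : τ ⊆ σ) (hB : Bad V τ) (hnf : ∃ ρ ∈ τ, ρ ∉ Set.range (e n))
    (hfr : ∀ σ' ∈ Φ', ¬ τ ⊆ σ' → (∑ ρ ∈ τ, ρ) ∉ σ') : GoodPlay n V Φ (star Φ' τ) := by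
  induction h with
  | done Φ => exact GoodPlay.move Φ _ σ τ hσ hτ hB hnf hfr (GoodPlay.done _)
  | move Φ Φ' σ₀ τ₀ hσ₀ hτ₀ hB₀ hnf₀ hfr₀ _ ih =>
    exact GoodPlay.move Φ _ σ₀ τ₀ hσ₀ hτ₀ hB₀ hnf₀ hfr₀ (ih hσ hfr)


/-! ### F. The invariant along plays, and `PlayFacts` -/

/-- **THE INVARIANT ALONG A PLAY** (convenient nonempty table): smooth maximal cones, no cone containing the whole frame, pairwise separation — all three
survive every E1-legal star. [OURS · L1 W4.5b · (B4α0) core] -/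
theorem invariant_of_reach {V : Finset (Fin n → ℕ)} (hV : V.Nonempty) {Φ Φ' : Finset (Finset (Ray n))}
    (h : Reach V Φ Φ') (hS : ∀ σ ∈ Φ, IsSmoothCone σ) (hN : ∀ σ ∈ Φ, ¬ Finset.univ.image (e n) ⊆ σ)
    (hSep : ∀ σ₁ ∈ Φ, ∀ σ₂ ∈ Φ, σ₁ ≠ σ₂ → ∃ u : Ray n, (∀ ρ ∈ σ₁, ρ ∈ σ₂ → u ⬝ᵥ ρ = 0) ∧
      (∀ ρ ∈ σ₁, ρ ∉ σ₂ → 0 < u ⬝ᵥ ρ) ∧ (∀ ρ ∈ σ₂, ρ ∉ σ₁ → u ⬝ᵥ ρ < 0)) :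
    (∀ σ ∈ Φ', IsSmoothCone σ) ∧ (∀ σ ∈ Φ', ¬ Finset.univ.image (e n) ⊆ σ) ∧
      (∀ σ₁ ∈ Φ', ∀ σ₂ ∈ Φ', σ₁ ≠ σ₂ → ∃ u : Ray n, (∀ ρ ∈ σ₁, ρ ∈ σ₂ → u ⬝ᵥ ρ = 0) ∧
        (∀ ρ ∈ σ₁, ρ ∉ σ₂ → 0 < u ⬝ᵥ ρ) ∧ (∀ ρ ∈ σ₂, ρ ∉ σ₁ → u ⬝ᵥ ρ < 0)) := by
  induction h with
  | refl => exact ⟨hS, hN, hSep⟩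
  | step F₂ τ σ _ hσ hτ _ hB ih =>
    obtain ⟨hS₂, hN₂, hSep₂⟩ := ih
    exact ⟨isSmoothCone_star hS₂,
      not_frame_subset_star hV hS₂ hB (fun σ' hσ' _ => hN₂ σ' hσ')
        (fun σ' hσ' _ t _ h => hN₂ σ' hσ' (h.trans (Finset.erase_subset _ _))),
      separated_star hS₂ hSep₂ hσ hτ⟩

/-- **FROM A PLAY TO A GOOD PLAY**: under the invariant, every E1-legal play IS a head-style good play (each centre has a non-frame ray by convenience,
each new ray is fresh by separation). [OURS · L1 W4.5b · (B4α0) core] -/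
theorem goodPlay_of_reach {V : Finset (Fin n → ℕ)} (hVc : IsConvenientTable V) (hV : V.Nonempty) {Φ Φ' : Finset (Finset (Ray n))}
    (h : Reach V Φ Φ') (hS : ∀ σ ∈ Φ, IsSmoothCone σ) (hN : ∀ σ ∈ Φ, ¬ Finset.univ.image (e n) ⊆ σ)
    (hSep : ∀ σ₁ ∈ Φ, ∀ σ₂ ∈ Φ, σ₁ ≠ σ₂ → ∃ u : Ray n, (∀ ρ ∈ σ₁, ρ ∈ σ₂ → u ⬝ᵥ ρ = 0) ∧
      (∀ ρ ∈ σ₁, ρ ∉ σ₂ → 0 < u ⬝ᵥ ρ) ∧ (∀ ρ ∈ σ₂, ρ ∉ σ₁ → u ⬝ᵥ ρ < 0)) :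
    GoodPlay n V Φ Φ' := by
  induction h with
  | refl => exact GoodPlay.done _
  | step F₂ τ σ hR hσ hτ _ hB ih =>
    obtain ⟨_, hN₂, hSep₂⟩ := invariant_of_reach hV hR hS hN hSep
    exact goodPlay_snoc ih hσ hτ hB (exists_not_mem_range_e_of_bad hVc hτ (hN₂ σ hσ) hB)
      (fun σ' hσ' h' => sum_not_mem_of_separated hSep₂ hσ hτ hσ' h')

/-- The point-star position (after the forced first move) satisfies the invariant, provided the full frame is `Bad` (i.e. `n ≥ 2` on a convenient
table). [OURS · L1 W4.5b] -/
theorem invariant_pointStar {V : Finset (Fin n → ℕ)} (hV : V.Nonempty) (hB : Bad V (Finset.univ.image (e n))) :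
    (∀ σ ∈ star (orthantFan n) (Finset.univ.image (e n)), IsSmoothCone σ) ∧
    (∀ σ ∈ star (orthantFan n) (Finset.univ.image (e n)), ¬ Finset.univ.image (e n) ⊆ σ) ∧
    (∀ σ₁ ∈ star (orthantFan n) (Finset.univ.image (e n)), ∀ σ₂ ∈ star (orthantFan n) (Finset.univ.image (e n)), σ₁ ≠ σ₂ →
      ∃ u : Ray n, (∀ ρ ∈ σ₁, ρ ∈ σ₂ → u ⬝ᵥ ρ = 0) ∧
        (∀ ρ ∈ σ₁, ρ ∉ σ₂ → 0 < u ⬝ᵥ ρ) ∧ (∀ ρ ∈ σ₂, ρ ∉ σ₁ → u ⬝ᵥ ρ < 0)) := by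
  classical
  have hS₀ : ∀ σ ∈ orthantFan n, IsSmoothCone σ := fun σ hσ => by
    rw [orthantFan, Finset.mem_singleton] at hσ; rw [hσ]; exact isSmoothCone_orthant
  have hmem : Finset.univ.image (e n) ∈ orthantFan n := by rw [orthantFan]; exact Finset.mem_singleton_self _
  have hSep₀ : ∀ σ₁ ∈ orthantFan n, ∀ σ₂ ∈ orthantFan n, σ₁ ≠ σ₂ → ∃ u : Ray n, (∀ ρ ∈ σ₁, ρ ∈ σ₂ → u ⬝ᵥ ρ = 0) ∧
      (∀ ρ ∈ σ₁, ρ ∉ σ₂ → 0 < u ⬝ᵥ ρ) ∧ (∀ ρ ∈ σ₂, ρ ∉ σ₁ → u ⬝ᵥ ρ < 0) := by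
    intro σ₁ hσ₁ σ₂ hσ₂ hne
    rw [orthantFan, Finset.mem_singleton] at hσ₁ hσ₂
    exact absurd (hσ₁.trans hσ₂.symm) hne
  refine ⟨isSmoothCone_star hS₀, ?_, separated_star hS₀ hSep₀ hmem le_rfl⟩
  refine not_frame_subset_star hV hS₀ hB (fun σ hσ h => ?_) (fun σ hσ _ t ht h => ?_)
  · rw [orthantFan, Finset.mem_singleton] at hσ
    exact absurd (hσ ▸ le_rfl) h
  · rw [orthantFan, Finset.mem_singleton] at hσ
    subst hσ
    exact Finset.notMem_erase t _ (h ht)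

/-- If the orthant is already won on a convenient table then `n ≤ 1`, and the point-star position is won too (for `n = 1` it IS the orthant, for
`n = 0` it is empty). [OURS · L1 W4.5b] -/
theorem won_pointStar_of_won_orthant {V : Finset (Fin n → ℕ)} (hVc : IsConvenientTable V) (hW : Won V (orthantFan n)) :
    Won V (star (orthantFan n) (Finset.univ.image (e n))) := by
  classical
  have hnb : ¬ Bad V (Finset.univ.image (e n)) := hW _ (by rw [orthantFan]; exact Finset.mem_singleton_self _)
  rcases Nat.lt_or_ge n 2 with hn | hn
  · interval_cases n
    · have h0 : (Finset.univ : Finset (Fin 0)).image (e 0) = ∅ := by simp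
      rw [h0, star_empty_eq]
      intro σ hσ; simp at hσ
    · have h1 : (Finset.univ : Finset (Fin 1)).image (e 1) = {e 1 0} := by
        rw [Finset.univ_unique, Finset.image_singleton]; rfl
      rw [h1, star_singleton_eq]
      exact hW
  · exfalso
    obtain ⟨m, rfl⟩ := Nat.exists_eq_add_of_le' hn
    exact hnb (bad_frame_of_ne hVc (i := (0 : Fin (m + 2))) (j := (1 : Fin (m + 2))) (Fin.zero_lt_one).ne)

/-- **(B4α0) `playFacts : PlayFacts n` — PROVED.**  Every won E1-legal play of the local fan game from the orthant on a CONVENIENT nonempty table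
yields a HEAD-STYLE GOOD play from the point-star position `star (orthantFan n) frame` to a won position: its first move is forced to be the full-frame
star (convenience: `not_bad_coordinateFace`), and along the rest of the play every maximal cone stays SMOOTH, no cone contains the whole frame (so every
`Bad` centre has a NON-FRAME ray), and any two maximal cones are SEPARATED by an integral functional (the fan property «cones meet along common faces»,
carried through each star by the explicit update `N·u + (a* − b*)` in the dual basis of one smooth old cone) — which is exactly FRESHNESS of the new ray.
The won position returned is the given one.  [OURS · L1 W4.5b · ND-K5 brick (B4α0) of SPEC v9 §13.14 (idea-1 ROUND 12), closes `playFacts` BY NAME;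
AI-written (res-L1-w45b-iso-w3 g0), weaker than expert review; counted 0] -/
theorem playFacts (n : ℕ) : PlayFacts n := by
  classical
  intro V hVc hV Φ' hR hW
  rcases reach_eq_or_exists_first_move hR with h | ⟨σ, hσ, τ, hτσ, -, hB, hR'⟩
  · subst h
    exact ⟨_, GoodPlay.done _, won_pointStar_of_won_orthant hVc hW⟩
  · rw [orthantFan, Finset.mem_singleton] at hσ
    subst hσ
    have hτ : τ = Finset.univ.image (e n) := eq_frame_of_bad_subset_frame hVc hτσ hB
    subst hτ
    obtain ⟨hS₁, hN₁, hSep₁⟩ := invariant_pointStar hV hB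
    exact ⟨Φ', goodPlay_of_reach hVc hV hR' hS₁ hN₁ hSep₁, hW⟩


end Summit.ResolutionOfSingularities.ResolutionOfSingularities.Cruxes.EquisingularLiftNat.Sections.ND

end
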